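import Mathlib
import HarnessLib
import Summits.AtomisticToContinuum.Statement
import Summits.AtomisticToContinuum.Crystallization.Theses.ContactSaturationLadder

/-!
# The glue of the twelve-contact-band split, PROVED: `ContactSaturationLadder.TightTextureRungGlue`
# (route ContactSaturationLadder rev 1, support item stmt-AtomisticToContinuum-31518; decomposition cell decomp-a2c, lens-1 g7/g8)

The gen-7 split of `B = TightTextureRung` (stmt-30304) into the three contact-tolerance bands
`E₁ = NearKissingTextureRung` (31515: (1/2000)-loose 5-balls sparse), `E₂ = TwelveGapTextureRung` (31516: (1/60)-loose sparse but
(1/2000)-loose dense) and `P = ThirteenContactTextureRung` (31517: (3/50)-loose sparse but (1/60)-loose dense) glues back by two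
excluded middles («are the (1/2000)-loose balls sparse?», then «the (1/60)-loose ones?») and `¬ sparse ⇔ dense`.  Pure logic on the
TREE decls — no energy, no facts, no local definitions (extracted from the lens-1 g7 node file `TwelveContactBands.lean` §12b,
`tree_glue_holds`).
-/

namespace Summit.AtomisticToContinuum.Crystallization.Theorems.ContactSaturationLadderTightTextureRungGlue

open Summit.AtomisticToContinuum.Crystallization.Theses

/-- **THE GLUE ITEM stmt-AtomisticToContinuum-31518 `ContactSaturationLadder.TightTextureRungGlue`** — `E₁ → E₂ → P → B`, PROVED. -/
theorem tightTextureRungGlue : ContactSaturationLadder.TightTextureRungGlue := by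
  unfold ContactSaturationLadder.TightTextureRungGlue ContactSaturationLadder.TightTextureRung
  intro h₁ h₂ h₃ δ _ _ x hx hdd hmh hor hHS hLS hVS _ hsp
  have g₁ := h₁ x hx hdd hmh hor hHS hLS hVS
  have g₂ := h₂ x hx hdd hmh hor hHS hLS hVS
  have g₃ := h₃ x hx hdd hmh hor hHS hLS hVS hsp
  refine (Classical.em _).elim (fun ha => g₁ ha) (fun ha => ?_)
  refine (Classical.em _).elim (fun hb => g₂ hb ?_) (fun hb => g₃ ?_)
  · simpa only [not_forall, Filter.not_eventually, not_le, exists_prop] using ha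
  · simpa only [not_forall, Filter.not_eventually, not_le, exists_prop] using hb

end Summit.AtomisticToContinuum.Crystallization.Theorems.ContactSaturationLadderTightTextureRungGlue
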